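import Summits.Ventures.CertifiedManyBodySolver.Observables.ClusterCapFieldTransport
import Summits.Ventures.CertifiedManyBodySolver.Upper.DWaveSourceOpenClusterCapTTPrime
import HarnessLib

/-!
# Reading ONE certified sourced cluster state at EVERY coupling `U`: the open box energy is affine in `U` with slope the
# double-occupancy operator, so a certificate that prints the state's energy AND its exact double occupancy caps the sourced
# energy at every `U′` — `U`-transport on the PRODUCER side, exact (the `U`-twin of `ClusterCapFieldTransport` / `ClusterCapTPrimeTransport`)

Cell hubbard-obs (rung R0 «points → families», nodes lane; row «pinning-field response menu nodes — h-chords», seat hubbard-obs-pin-1 g4).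
The open pair-sourced `a × b` cluster `A_C(U; μ, h) = dWaveSourceOpenBox a b U μ h = hamiltonianWith (rectBoxGraph a b) 1 U μ − h·(P_C + P_Cᴴ)`
(pin-1 g2, p468923) is AFFINE in `U` with slope the double-occupancy operator `D := Σ_{x ∈ box} n_{x↑} n_{x↓}`
(`hamiltonian_coupling_affine`, `dWaveSourceOpenBox_coupling_affine`; the `t–t′` box `dWaveSourceOpenBoxTT'` likewise, its diagonal hopping being
`U`-free): `Re⟨ψ, A_C(U′)ψ⟩ = Re⟨ψ, A_C(U)ψ⟩ + (U′ − U)·Re⟨ψ, Dψ⟩` (`re_expect_dWaveSourceOpenBox_coupling`). So a producer that prints ONE exact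
rational more per vector — the DOUBLE-OCCUPANCY ROW `d := Re⟨ψ, Dψ⟩/(ab)` (hubbard-cq-pilot-1's `docc_per_site` column of
`pub/hubbard-cq/pilot/PIN1-CAPX-RATIONALS.json`, kit j265582, ALREADY PRINTED for the 19 capU2/capU3 vectors) — makes the same vector an energy CAP at
every `U′`: moving DOWN in `U` (`U′ ≤ U`) consumes a LOWER docc row and gives cap `u + (U′ − U)·dlo` (`clusterCap_coupling_down`); moving UP consumes the
UPPER row and gives `u + (U′ − U)·dhi` (`clusterCap_coupling_up`). §3 packages this for CLAIM NODES: the DOCC NODE (standard five conjuncts + two docc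
rows) ⇒ the standard node at `U′` (`clusterNode_at_coupling_{down,up}_of_doccNode`), and the TWO-FIELD DOCC NODE (obsth-2's seven-conjunct two-field node +
two docc rows, NINE conjuncts) ⇒ obsth-2's two-field node at `U′` (`twoFieldNode_at_coupling_{down,up}_of_twoFieldDoccNode`; `D` is `h`-free so both fields
move by the same `(U′ − U)·D`; `t–t′` twin `twoFieldNodeTT'_at_coupling_{down,up}_of_twoFieldDoccNodeTT'`) — then `clusterNode_at_field_{down,up}_of_twoFieldNode`
reads it at every field: ONE certified vector with rows (E(h), E(0), N, D) caps the sourced energy on the whole `(U, h)` plane of its `(t′, μ)`; with the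
`k₂` row of `ClusterCapTPrimeTransport` also `t′`. §4 composes with pin-1's torus row (`sourcedEnergyUpperRow_at_coupling_{down,up}_of_doccNode`).
For producers (EXACT rational per site): `d = Re⟨v|Σ_x numberOp x 0 * numberOp x 1|v⟩/⟨v|v⟩/(ab)` (both spins up-down, per site).
PLANNING [exact arithmetic on the CAPX json + certified lowers #507/#426/#500, float display; leaves are hubbard-cq's]: the 19 `t′ = 0` vectors transported
from `U = 8` give canonical density-7/8 finite-field response floors at NEW couplings — (6, 7/8, 0): m ≥ 0.0377 @ h 0.40406 · 0.2286 @ 0.60609 · 0.3439 @ 0.80812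
(#500); (4, 7/8, 0): 0.2121 @ 0.60609 · 0.3457 @ 0.80812 (#426); (2, 7/8, 0): 0.1320 · 0.2997 (#507; dominated by pin-2's B′ class) — the U = 8 column
0.0351512 / 0.0946828 / 0.2495134 / 0.3454364 is reproduced exactly by the same script at U′ = U.

HONEST FRAMING: exact bookkeeping on ONE trial state (a variational CEILING moved along its own affine line in `U`); the leaves it feeds are
CONDITIONAL cap rows / large-field finite-h RESPONSE floors at other `U` (claim nodes as hypotheses, CANDIDATE until readers + referee), never order
parameters, no phase word, not a superconductivity verdict. Zero compute; no definition; no named fact; no `sorry`.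
References: D. Ruelle, *Statistical Mechanics: Rigorous Results* (1969) §3.3 (trial states); Koma–Tasaki, J. Stat. Phys. 76 (1994) 745 §1.
-/

noncomputable section

namespace Summit.Ventures.CertifiedManyBodySolver.Observables

open Matrix Literature.Probability.LatticeModels
open Literature.MathematicalPhysics.QuantumLattice Literature.MathematicalPhysics.QuantumLattice.ThermodynamicLimit
open Literature.MathematicalPhysics.QuantumLattice.TwoCluster
open scoped ComplexOrder

/-! ### §1 The open box is affine in the coupling -/

section AffineU

/-- The Hubbard Hamiltonian is affine in `U` with slope the double-occupancy operator:
`hamiltonian G t U′ = hamiltonian G t U + (U′ − U)·Σ_x n_{x↑}n_{x↓}`. [folklore] -/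
theorem hamiltonian_coupling_affine {Λ : Type*} [LinearOrder Λ] [Fintype Λ] (G : SimpleGraph Λ) [DecidableRel G.Adj]
    (t U U' : ℝ) :
    hamiltonian G t U' = hamiltonian G t U + ((U' - U : ℝ) : ℂ) • ∑ x : Λ, numberOp x 0 * numberOp x 1 := by
  simp only [hamiltonian]
  push_cast
  module

variable (a b : ℕ) (μ h : ℝ)

/-- **`A_C(U′) = A_C(U) + (U′ − U)·D`**, `D = Σ_{x ∈ box} n_{x↑}n_{x↓}`: the open sourced box is affine in `U`. [cite: KomaTasaki1994, §1] -/
theorem dWaveSourceOpenBox_coupling_affine (U U' : ℝ) :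
    dWaveSourceOpenBox a b U' μ h =
      dWaveSourceOpenBox a b U μ h + ((U' - U : ℝ) : ℂ) • ∑ x : Fin a ×ₗ Fin b, numberOp x 0 * numberOp x 1 := by
  unfold dWaveSourceOpenBox
  rw [hamiltonianWith_eq, hamiltonianWith_eq, hamiltonian_coupling_affine (rectBoxGraph a b) 1 U U']
  abel

/-- The `t–t′` open sourced box is affine in `U` with the same slope (its diagonal hopping is `U`-free). [cite: XuEtAl2024, eq. (1)] -/
theorem dWaveSourceOpenBoxTT'_coupling_affine (tp U U' : ℝ) :
    dWaveSourceOpenBoxTT' a b tp U' μ h =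
      dWaveSourceOpenBoxTT' a b tp U μ h + ((U' - U : ℝ) : ℂ) • ∑ x : Fin a ×ₗ Fin b, numberOp x 0 * numberOp x 1 := by
  unfold dWaveSourceOpenBoxTT'
  rw [dWaveSourceOpenBox_coupling_affine a b μ h U U']
  abel

/-- Real parts along the `U` affine line: `Re⟨ψ, A_C(U′)ψ⟩ = Re⟨ψ, A_C(U)ψ⟩ + (U′ − U)·Re⟨ψ, Dψ⟩`. [cite: KomaTasaki1994, §1] -/
theorem re_expect_dWaveSourceOpenBox_coupling (U U' : ℝ) (ψ : Fock (Orb (Fin a ×ₗ Fin b))) :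
    (star ψ ⬝ᵥ (dWaveSourceOpenBox a b U' μ h *ᵥ ψ)).re =
      (star ψ ⬝ᵥ (dWaveSourceOpenBox a b U μ h *ᵥ ψ)).re +
        (U' - U) * (star ψ ⬝ᵥ ((∑ x : Fin a ×ₗ Fin b, numberOp x 0 * numberOp x 1) *ᵥ ψ)).re := by
  rw [dWaveSourceOpenBox_coupling_affine a b μ h U U']
  simp only [Matrix.add_mulVec, dotProduct_add, Matrix.smul_mulVec, dotProduct_smul, smul_eq_mul, Complex.add_re,
    Complex.re_ofReal_mul]

/-- Real parts along the `U` affine line, `t–t′` box. [cite: XuEtAl2024, eq. (1)] -/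
theorem re_expect_dWaveSourceOpenBoxTT'_coupling (tp U U' : ℝ) (ψ : Fock (Orb (Fin a ×ₗ Fin b))) :
    (star ψ ⬝ᵥ (dWaveSourceOpenBoxTT' a b tp U' μ h *ᵥ ψ)).re =
      (star ψ ⬝ᵥ (dWaveSourceOpenBoxTT' a b tp U μ h *ᵥ ψ)).re +
        (U' - U) * (star ψ ⬝ᵥ ((∑ x : Fin a ×ₗ Fin b, numberOp x 0 * numberOp x 1) *ᵥ ψ)).re := by
  rw [dWaveSourceOpenBoxTT'_coupling_affine a b μ h tp U U']
  simp only [Matrix.add_mulVec, dotProduct_add, Matrix.smul_mulVec, dotProduct_smul, smul_eq_mul, Complex.add_re,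
    Complex.re_ofReal_mul]

end AffineU

/-! ### §2 Caps and floors moved along `U` -/

section Caps

variable {a b : ℕ} {U U' μ h u dlo dhi : ℝ} {ψ : Fock (Orb (Fin a ×ₗ Fin b))}

/-- **Reading DOWN in `U`** (`U′ ≤ U`): cap `u` at `U` and the LOWER docc row `dlo·(ab) ≤ Re⟨ψ, Dψ⟩` give cap `u + (U′ − U)·dlo` at `U′`.
[cite: Ruelle1969, §3.3] -/
theorem clusterCap_coupling_down (hU : U' ≤ U)
    (hE : (star ψ ⬝ᵥ (dWaveSourceOpenBox a b U μ h *ᵥ ψ)).re ≤ u * ((a : ℝ) * b))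
    (hD : dlo * ((a : ℝ) * b) ≤ (star ψ ⬝ᵥ ((∑ x : Fin a ×ₗ Fin b, numberOp x 0 * numberOp x 1) *ᵥ ψ)).re) :
    (star ψ ⬝ᵥ (dWaveSourceOpenBox a b U' μ h *ᵥ ψ)).re ≤ (u + (U' - U) * dlo) * ((a : ℝ) * b) := by
  rw [re_expect_dWaveSourceOpenBox_coupling a b μ h U U' ψ]
  have h1 : 0 ≤ U - U' := sub_nonneg.2 hU
  nlinarith [mul_le_mul_of_nonneg_left hD h1]

/-- **Reading UP in `U`** (`U ≤ U′`): cap `u` at `U` and the UPPER docc row give cap `u + (U′ − U)·dhi` at `U′`. [cite: Ruelle1969, §3.3] -/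
theorem clusterCap_coupling_up (hU : U ≤ U')
    (hE : (star ψ ⬝ᵥ (dWaveSourceOpenBox a b U μ h *ᵥ ψ)).re ≤ u * ((a : ℝ) * b))
    (hD : (star ψ ⬝ᵥ ((∑ x : Fin a ×ₗ Fin b, numberOp x 0 * numberOp x 1) *ᵥ ψ)).re ≤ dhi * ((a : ℝ) * b)) :
    (star ψ ⬝ᵥ (dWaveSourceOpenBox a b U' μ h *ᵥ ψ)).re ≤ (u + (U' - U) * dhi) * ((a : ℝ) * b) := by
  rw [re_expect_dWaveSourceOpenBox_coupling a b μ h U U' ψ]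
  have h1 : 0 ≤ U' - U := sub_nonneg.2 hU
  nlinarith [mul_le_mul_of_nonneg_left hD h1]

/-- Floors DOWN in `U` (`U′ ≤ U`): floor `u` at `U` and the UPPER docc row give floor `u + (U′ − U)·dhi` at `U′`. [cite: Ruelle1969, §3.3] -/
theorem clusterFloor_coupling_down (hU : U' ≤ U)
    (hE : u * ((a : ℝ) * b) ≤ (star ψ ⬝ᵥ (dWaveSourceOpenBox a b U μ h *ᵥ ψ)).re)
    (hD : (star ψ ⬝ᵥ ((∑ x : Fin a ×ₗ Fin b, numberOp x 0 * numberOp x 1) *ᵥ ψ)).re ≤ dhi * ((a : ℝ) * b)) :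
    (u + (U' - U) * dhi) * ((a : ℝ) * b) ≤ (star ψ ⬝ᵥ (dWaveSourceOpenBox a b U' μ h *ᵥ ψ)).re := by
  rw [re_expect_dWaveSourceOpenBox_coupling a b μ h U U' ψ]
  have h1 : 0 ≤ U - U' := sub_nonneg.2 hU
  nlinarith [mul_le_mul_of_nonneg_left hD h1]

/-- Floors UP in `U` (`U ≤ U′`): floor `u` at `U` and the LOWER docc row give floor `u + (U′ − U)·dlo` at `U′`. [cite: Ruelle1969, §3.3] -/
theorem clusterFloor_coupling_up (hU : U ≤ U')
    (hE : u * ((a : ℝ) * b) ≤ (star ψ ⬝ᵥ (dWaveSourceOpenBox a b U μ h *ᵥ ψ)).re)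
    (hD : dlo * ((a : ℝ) * b) ≤ (star ψ ⬝ᵥ ((∑ x : Fin a ×ₗ Fin b, numberOp x 0 * numberOp x 1) *ᵥ ψ)).re) :
    (u + (U' - U) * dlo) * ((a : ℝ) * b) ≤ (star ψ ⬝ᵥ (dWaveSourceOpenBox a b U' μ h *ᵥ ψ)).re := by
  rw [re_expect_dWaveSourceOpenBox_coupling a b μ h U U' ψ]
  have h1 : 0 ≤ U' - U := sub_nonneg.2 hU
  nlinarith [mul_le_mul_of_nonneg_left hD h1]

variable {tp : ℝ}

/-- Caps DOWN in `U`, `t–t′` box. [cite: Ruelle1969, §3.3] -/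
theorem clusterCapTT'_coupling_down (hU : U' ≤ U)
    (hE : (star ψ ⬝ᵥ (dWaveSourceOpenBoxTT' a b tp U μ h *ᵥ ψ)).re ≤ u * ((a : ℝ) * b))
    (hD : dlo * ((a : ℝ) * b) ≤ (star ψ ⬝ᵥ ((∑ x : Fin a ×ₗ Fin b, numberOp x 0 * numberOp x 1) *ᵥ ψ)).re) :
    (star ψ ⬝ᵥ (dWaveSourceOpenBoxTT' a b tp U' μ h *ᵥ ψ)).re ≤ (u + (U' - U) * dlo) * ((a : ℝ) * b) := by
  rw [re_expect_dWaveSourceOpenBoxTT'_coupling a b μ h tp U U' ψ]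
  have h1 : 0 ≤ U - U' := sub_nonneg.2 hU
  nlinarith [mul_le_mul_of_nonneg_left hD h1]

/-- Caps UP in `U`, `t–t′` box. [cite: Ruelle1969, §3.3] -/
theorem clusterCapTT'_coupling_up (hU : U ≤ U')
    (hE : (star ψ ⬝ᵥ (dWaveSourceOpenBoxTT' a b tp U μ h *ᵥ ψ)).re ≤ u * ((a : ℝ) * b))
    (hD : (star ψ ⬝ᵥ ((∑ x : Fin a ×ₗ Fin b, numberOp x 0 * numberOp x 1) *ᵥ ψ)).re ≤ dhi * ((a : ℝ) * b)) :
    (star ψ ⬝ᵥ (dWaveSourceOpenBoxTT' a b tp U' μ h *ᵥ ψ)).re ≤ (u + (U' - U) * dhi) * ((a : ℝ) * b) := by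
  rw [re_expect_dWaveSourceOpenBoxTT'_coupling a b μ h tp U U' ψ]
  have h1 : 0 ≤ U' - U := sub_nonneg.2 hU
  nlinarith [mul_le_mul_of_nonneg_left hD h1]

/-- Floors DOWN in `U`, `t–t′` box. [cite: Ruelle1969, §3.3] -/
theorem clusterFloorTT'_coupling_down (hU : U' ≤ U)
    (hE : u * ((a : ℝ) * b) ≤ (star ψ ⬝ᵥ (dWaveSourceOpenBoxTT' a b tp U μ h *ᵥ ψ)).re)
    (hD : (star ψ ⬝ᵥ ((∑ x : Fin a ×ₗ Fin b, numberOp x 0 * numberOp x 1) *ᵥ ψ)).re ≤ dhi * ((a : ℝ) * b)) :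
    (u + (U' - U) * dhi) * ((a : ℝ) * b) ≤ (star ψ ⬝ᵥ (dWaveSourceOpenBoxTT' a b tp U' μ h *ᵥ ψ)).re := by
  rw [re_expect_dWaveSourceOpenBoxTT'_coupling a b μ h tp U U' ψ]
  have h1 : 0 ≤ U - U' := sub_nonneg.2 hU
  nlinarith [mul_le_mul_of_nonneg_left hD h1]

/-- Floors UP in `U`, `t–t′` box. [cite: Ruelle1969, §3.3] -/
theorem clusterFloorTT'_coupling_up (hU : U ≤ U')
    (hE : u * ((a : ℝ) * b) ≤ (star ψ ⬝ᵥ (dWaveSourceOpenBoxTT' a b tp U μ h *ᵥ ψ)).re)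
    (hD : dlo * ((a : ℝ) * b) ≤ (star ψ ⬝ᵥ ((∑ x : Fin a ×ₗ Fin b, numberOp x 0 * numberOp x 1) *ᵥ ψ)).re) :
    (u + (U' - U) * dlo) * ((a : ℝ) * b) ≤ (star ψ ⬝ᵥ (dWaveSourceOpenBoxTT' a b tp U' μ h *ᵥ ψ)).re := by
  rw [re_expect_dWaveSourceOpenBoxTT'_coupling a b μ h tp U U' ψ]
  have h1 : 0 ≤ U' - U := sub_nonneg.2 hU
  nlinarith [mul_le_mul_of_nonneg_left hD h1]

end Caps

/-! ### §3 Claim-node shapes: the DOCC node and the TWO-FIELD DOCC node read at another `U` -/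

section Nodes

variable {a b : ℕ} (μ : ℝ) {U U' h u nlo nhi e0lo e0hi dlo dhi : ℝ}

/-- **Docc node ⇒ standard node at a SMALLER `U`** (`U′ ≤ U`): from
`∃ ψ, parity ∧ unit ∧ E_U(h) ≤ u·(ab) ∧ nlo·(ab) ≤ N ∧ N ≤ nhi·(ab) ∧ dlo·(ab) ≤ D ∧ D ≤ dhi·(ab)` (v1 order plus two trailing docc rows,
`D = Re⟨ψ, Σ_x n_{x↑}n_{x↓} ψ⟩`) to the standard five-conjunct node at `U′` with cap `u + (U′ − U)·dlo`. [cite: Ruelle1969, §3.3] -/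
theorem clusterNode_at_coupling_down_of_doccNode (hU : U' ≤ U)
    (hC : ∃ ψ : Fock (Orb (Fin a ×ₗ Fin b)), HasParity 0 ψ ∧ star ψ ⬝ᵥ ψ = 1 ∧
      (star ψ ⬝ᵥ (dWaveSourceOpenBox a b U μ h *ᵥ ψ)).re ≤ u * ((a : ℝ) * b) ∧
      nlo * ((a : ℝ) * b) ≤ (star ψ ⬝ᵥ (totalNumber *ᵥ ψ)).re ∧
      (star ψ ⬝ᵥ (totalNumber *ᵥ ψ)).re ≤ nhi * ((a : ℝ) * b) ∧
      dlo * ((a : ℝ) * b) ≤ (star ψ ⬝ᵥ ((∑ x : Fin a ×ₗ Fin b, numberOp x 0 * numberOp x 1) *ᵥ ψ)).re ∧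
      (star ψ ⬝ᵥ ((∑ x : Fin a ×ₗ Fin b, numberOp x 0 * numberOp x 1) *ᵥ ψ)).re ≤ dhi * ((a : ℝ) * b)) :
    ∃ ψ : Fock (Orb (Fin a ×ₗ Fin b)), HasParity 0 ψ ∧ star ψ ⬝ᵥ ψ = 1 ∧
      (star ψ ⬝ᵥ (dWaveSourceOpenBox a b U' μ h *ᵥ ψ)).re ≤ (u + (U' - U) * dlo) * ((a : ℝ) * b) ∧
      nlo * ((a : ℝ) * b) ≤ (star ψ ⬝ᵥ (totalNumber *ᵥ ψ)).re ∧
      (star ψ ⬝ᵥ (totalNumber *ᵥ ψ)).re ≤ nhi * ((a : ℝ) * b) := by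
  obtain ⟨ψ, hp, h1, hE, hNlo, hNhi, hDlo, -⟩ := hC
  exact ⟨ψ, hp, h1, clusterCap_coupling_down hU hE hDlo, hNlo, hNhi⟩

/-- **Docc node ⇒ standard node at a LARGER `U`** (`U ≤ U′`; cap `u + (U′ − U)·dhi`). [cite: Ruelle1969, §3.3] -/
theorem clusterNode_at_coupling_up_of_doccNode (hU : U ≤ U')
    (hC : ∃ ψ : Fock (Orb (Fin a ×ₗ Fin b)), HasParity 0 ψ ∧ star ψ ⬝ᵥ ψ = 1 ∧
      (star ψ ⬝ᵥ (dWaveSourceOpenBox a b U μ h *ᵥ ψ)).re ≤ u * ((a : ℝ) * b) ∧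
      nlo * ((a : ℝ) * b) ≤ (star ψ ⬝ᵥ (totalNumber *ᵥ ψ)).re ∧
      (star ψ ⬝ᵥ (totalNumber *ᵥ ψ)).re ≤ nhi * ((a : ℝ) * b) ∧
      dlo * ((a : ℝ) * b) ≤ (star ψ ⬝ᵥ ((∑ x : Fin a ×ₗ Fin b, numberOp x 0 * numberOp x 1) *ᵥ ψ)).re ∧
      (star ψ ⬝ᵥ ((∑ x : Fin a ×ₗ Fin b, numberOp x 0 * numberOp x 1) *ᵥ ψ)).re ≤ dhi * ((a : ℝ) * b)) :
    ∃ ψ : Fock (Orb (Fin a ×ₗ Fin b)), HasParity 0 ψ ∧ star ψ ⬝ᵥ ψ = 1 ∧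
      (star ψ ⬝ᵥ (dWaveSourceOpenBox a b U' μ h *ᵥ ψ)).re ≤ (u + (U' - U) * dhi) * ((a : ℝ) * b) ∧
      nlo * ((a : ℝ) * b) ≤ (star ψ ⬝ᵥ (totalNumber *ᵥ ψ)).re ∧
      (star ψ ⬝ᵥ (totalNumber *ᵥ ψ)).re ≤ nhi * ((a : ℝ) * b) := by
  obtain ⟨ψ, hp, h1, hE, hNlo, hNhi, -, hDhi⟩ := hC
  exact ⟨ψ, hp, h1, clusterCap_coupling_up hU hE hDhi, hNlo, hNhi⟩

/-- **Two-field docc node ⇒ two-field node at a SMALLER `U`** (`U′ ≤ U`): the NINE-conjunct node (obsth-2's seven-conjunct two-field node plus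
the two docc rows) gives obsth-2's seven-conjunct two-field node at `U′` with cap `u + (U′ − U)·dlo` and zero-field rows
`[e0lo + (U′ − U)·dhi, e0hi + (U′ − U)·dlo]` — `D` does not depend on `h`, so both fields move by the same `(U′ − U)·D`. Feed the result to
`clusterNode_at_field_{down,up}_of_twoFieldNode` to read it at any field. [cite: Ruelle1969, §3.3] -/
theorem twoFieldNode_at_coupling_down_of_twoFieldDoccNode (hU : U' ≤ U)
    (hC : ∃ ψ : Fock (Orb (Fin a ×ₗ Fin b)), HasParity 0 ψ ∧ star ψ ⬝ᵥ ψ = 1 ∧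
      (star ψ ⬝ᵥ (dWaveSourceOpenBox a b U μ h *ᵥ ψ)).re ≤ u * ((a : ℝ) * b) ∧
      nlo * ((a : ℝ) * b) ≤ (star ψ ⬝ᵥ (totalNumber *ᵥ ψ)).re ∧
      (star ψ ⬝ᵥ (totalNumber *ᵥ ψ)).re ≤ nhi * ((a : ℝ) * b) ∧
      e0lo * ((a : ℝ) * b) ≤ (star ψ ⬝ᵥ (dWaveSourceOpenBox a b U μ 0 *ᵥ ψ)).re ∧
      (star ψ ⬝ᵥ (dWaveSourceOpenBox a b U μ 0 *ᵥ ψ)).re ≤ e0hi * ((a : ℝ) * b) ∧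
      dlo * ((a : ℝ) * b) ≤ (star ψ ⬝ᵥ ((∑ x : Fin a ×ₗ Fin b, numberOp x 0 * numberOp x 1) *ᵥ ψ)).re ∧
      (star ψ ⬝ᵥ ((∑ x : Fin a ×ₗ Fin b, numberOp x 0 * numberOp x 1) *ᵥ ψ)).re ≤ dhi * ((a : ℝ) * b)) :
    ∃ ψ : Fock (Orb (Fin a ×ₗ Fin b)), HasParity 0 ψ ∧ star ψ ⬝ᵥ ψ = 1 ∧
      (star ψ ⬝ᵥ (dWaveSourceOpenBox a b U' μ h *ᵥ ψ)).re ≤ (u + (U' - U) * dlo) * ((a : ℝ) * b) ∧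
      nlo * ((a : ℝ) * b) ≤ (star ψ ⬝ᵥ (totalNumber *ᵥ ψ)).re ∧
      (star ψ ⬝ᵥ (totalNumber *ᵥ ψ)).re ≤ nhi * ((a : ℝ) * b) ∧
      (e0lo + (U' - U) * dhi) * ((a : ℝ) * b) ≤ (star ψ ⬝ᵥ (dWaveSourceOpenBox a b U' μ 0 *ᵥ ψ)).re ∧
      (star ψ ⬝ᵥ (dWaveSourceOpenBox a b U' μ 0 *ᵥ ψ)).re ≤ (e0hi + (U' - U) * dlo) * ((a : ℝ) * b) := by
  obtain ⟨ψ, hp, h1, hE, hNlo, hNhi, hE0lo, hE0hi, hDlo, hDhi⟩ := hC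
  exact ⟨ψ, hp, h1, clusterCap_coupling_down hU hE hDlo, hNlo, hNhi, clusterFloor_coupling_down hU hE0lo hDhi,
    clusterCap_coupling_down hU hE0hi hDlo⟩

/-- **Two-field docc node ⇒ two-field node at a LARGER `U`** (`U ≤ U′`; cap `u + (U′ − U)·dhi`, zero-field rows
`[e0lo + (U′ − U)·dlo, e0hi + (U′ − U)·dhi]`). [cite: Ruelle1969, §3.3] -/
theorem twoFieldNode_at_coupling_up_of_twoFieldDoccNode (hU : U ≤ U')
    (hC : ∃ ψ : Fock (Orb (Fin a ×ₗ Fin b)), HasParity 0 ψ ∧ star ψ ⬝ᵥ ψ = 1 ∧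
      (star ψ ⬝ᵥ (dWaveSourceOpenBox a b U μ h *ᵥ ψ)).re ≤ u * ((a : ℝ) * b) ∧
      nlo * ((a : ℝ) * b) ≤ (star ψ ⬝ᵥ (totalNumber *ᵥ ψ)).re ∧
      (star ψ ⬝ᵥ (totalNumber *ᵥ ψ)).re ≤ nhi * ((a : ℝ) * b) ∧
      e0lo * ((a : ℝ) * b) ≤ (star ψ ⬝ᵥ (dWaveSourceOpenBox a b U μ 0 *ᵥ ψ)).re ∧
      (star ψ ⬝ᵥ (dWaveSourceOpenBox a b U μ 0 *ᵥ ψ)).re ≤ e0hi * ((a : ℝ) * b) ∧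
      dlo * ((a : ℝ) * b) ≤ (star ψ ⬝ᵥ ((∑ x : Fin a ×ₗ Fin b, numberOp x 0 * numberOp x 1) *ᵥ ψ)).re ∧
      (star ψ ⬝ᵥ ((∑ x : Fin a ×ₗ Fin b, numberOp x 0 * numberOp x 1) *ᵥ ψ)).re ≤ dhi * ((a : ℝ) * b)) :
    ∃ ψ : Fock (Orb (Fin a ×ₗ Fin b)), HasParity 0 ψ ∧ star ψ ⬝ᵥ ψ = 1 ∧
      (star ψ ⬝ᵥ (dWaveSourceOpenBox a b U' μ h *ᵥ ψ)).re ≤ (u + (U' - U) * dhi) * ((a : ℝ) * b) ∧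
      nlo * ((a : ℝ) * b) ≤ (star ψ ⬝ᵥ (totalNumber *ᵥ ψ)).re ∧
      (star ψ ⬝ᵥ (totalNumber *ᵥ ψ)).re ≤ nhi * ((a : ℝ) * b) ∧
      (e0lo + (U' - U) * dlo) * ((a : ℝ) * b) ≤ (star ψ ⬝ᵥ (dWaveSourceOpenBox a b U' μ 0 *ᵥ ψ)).re ∧
      (star ψ ⬝ᵥ (dWaveSourceOpenBox a b U' μ 0 *ᵥ ψ)).re ≤ (e0hi + (U' - U) * dhi) * ((a : ℝ) * b) := by
  obtain ⟨ψ, hp, h1, hE, hNlo, hNhi, hE0lo, hE0hi, hDlo, hDhi⟩ := hC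
  exact ⟨ψ, hp, h1, clusterCap_coupling_up hU hE hDhi, hNlo, hNhi, clusterFloor_coupling_up hU hE0lo hDlo,
    clusterCap_coupling_up hU hE0hi hDhi⟩

/-- **The two-field docc node read AT its own `U`** (drop the docc rows): obsth-2's seven-conjunct two-field node, so every existing
two-field consumer applies to the docc edition. [cite: Ruelle1969, §3.3] -/
theorem twoFieldNode_of_twoFieldDoccNode
    (hC : ∃ ψ : Fock (Orb (Fin a ×ₗ Fin b)), HasParity 0 ψ ∧ star ψ ⬝ᵥ ψ = 1 ∧
      (star ψ ⬝ᵥ (dWaveSourceOpenBox a b U μ h *ᵥ ψ)).re ≤ u * ((a : ℝ) * b) ∧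
      nlo * ((a : ℝ) * b) ≤ (star ψ ⬝ᵥ (totalNumber *ᵥ ψ)).re ∧
      (star ψ ⬝ᵥ (totalNumber *ᵥ ψ)).re ≤ nhi * ((a : ℝ) * b) ∧
      e0lo * ((a : ℝ) * b) ≤ (star ψ ⬝ᵥ (dWaveSourceOpenBox a b U μ 0 *ᵥ ψ)).re ∧
      (star ψ ⬝ᵥ (dWaveSourceOpenBox a b U μ 0 *ᵥ ψ)).re ≤ e0hi * ((a : ℝ) * b) ∧
      dlo * ((a : ℝ) * b) ≤ (star ψ ⬝ᵥ ((∑ x : Fin a ×ₗ Fin b, numberOp x 0 * numberOp x 1) *ᵥ ψ)).re ∧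
      (star ψ ⬝ᵥ ((∑ x : Fin a ×ₗ Fin b, numberOp x 0 * numberOp x 1) *ᵥ ψ)).re ≤ dhi * ((a : ℝ) * b)) :
    ∃ ψ : Fock (Orb (Fin a ×ₗ Fin b)), HasParity 0 ψ ∧ star ψ ⬝ᵥ ψ = 1 ∧
      (star ψ ⬝ᵥ (dWaveSourceOpenBox a b U μ h *ᵥ ψ)).re ≤ u * ((a : ℝ) * b) ∧
      nlo * ((a : ℝ) * b) ≤ (star ψ ⬝ᵥ (totalNumber *ᵥ ψ)).re ∧
      (star ψ ⬝ᵥ (totalNumber *ᵥ ψ)).re ≤ nhi * ((a : ℝ) * b) ∧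
      e0lo * ((a : ℝ) * b) ≤ (star ψ ⬝ᵥ (dWaveSourceOpenBox a b U μ 0 *ᵥ ψ)).re ∧
      (star ψ ⬝ᵥ (dWaveSourceOpenBox a b U μ 0 *ᵥ ψ)).re ≤ e0hi * ((a : ℝ) * b) := by
  obtain ⟨ψ, hp, h1, hE, hNlo, hNhi, hE0lo, hE0hi, -, -⟩ := hC
  exact ⟨ψ, hp, h1, hE, hNlo, hNhi, hE0lo, hE0hi⟩

/-- The two-field docc node with the field rows dropped: the DOCC node (five conjuncts + docc rows). [cite: Ruelle1969, §3.3] -/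
theorem doccNode_of_twoFieldDoccNode
    (hC : ∃ ψ : Fock (Orb (Fin a ×ₗ Fin b)), HasParity 0 ψ ∧ star ψ ⬝ᵥ ψ = 1 ∧
      (star ψ ⬝ᵥ (dWaveSourceOpenBox a b U μ h *ᵥ ψ)).re ≤ u * ((a : ℝ) * b) ∧
      nlo * ((a : ℝ) * b) ≤ (star ψ ⬝ᵥ (totalNumber *ᵥ ψ)).re ∧
      (star ψ ⬝ᵥ (totalNumber *ᵥ ψ)).re ≤ nhi * ((a : ℝ) * b) ∧
      e0lo * ((a : ℝ) * b) ≤ (star ψ ⬝ᵥ (dWaveSourceOpenBox a b U μ 0 *ᵥ ψ)).re ∧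
      (star ψ ⬝ᵥ (dWaveSourceOpenBox a b U μ 0 *ᵥ ψ)).re ≤ e0hi * ((a : ℝ) * b) ∧
      dlo * ((a : ℝ) * b) ≤ (star ψ ⬝ᵥ ((∑ x : Fin a ×ₗ Fin b, numberOp x 0 * numberOp x 1) *ᵥ ψ)).re ∧
      (star ψ ⬝ᵥ ((∑ x : Fin a ×ₗ Fin b, numberOp x 0 * numberOp x 1) *ᵥ ψ)).re ≤ dhi * ((a : ℝ) * b)) :
    ∃ ψ : Fock (Orb (Fin a ×ₗ Fin b)), HasParity 0 ψ ∧ star ψ ⬝ᵥ ψ = 1 ∧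
      (star ψ ⬝ᵥ (dWaveSourceOpenBox a b U μ h *ᵥ ψ)).re ≤ u * ((a : ℝ) * b) ∧
      nlo * ((a : ℝ) * b) ≤ (star ψ ⬝ᵥ (totalNumber *ᵥ ψ)).re ∧
      (star ψ ⬝ᵥ (totalNumber *ᵥ ψ)).re ≤ nhi * ((a : ℝ) * b) ∧
      dlo * ((a : ℝ) * b) ≤ (star ψ ⬝ᵥ ((∑ x : Fin a ×ₗ Fin b, numberOp x 0 * numberOp x 1) *ᵥ ψ)).re ∧
      (star ψ ⬝ᵥ ((∑ x : Fin a ×ₗ Fin b, numberOp x 0 * numberOp x 1) *ᵥ ψ)).re ≤ dhi * ((a : ℝ) * b) := by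
  obtain ⟨ψ, hp, h1, hE, hNlo, hNhi, -, -, hDlo, hDhi⟩ := hC
  exact ⟨ψ, hp, h1, hE, hNlo, hNhi, hDlo, hDhi⟩

variable (tp : ℝ)

/-- **Two-field docc node ⇒ two-field node at a SMALLER `U`, `t–t′` box** (`U′ ≤ U`). [cite: Ruelle1969, §3.3] -/
theorem twoFieldNodeTT'_at_coupling_down_of_twoFieldDoccNodeTT' (hU : U' ≤ U)
    (hC : ∃ ψ : Fock (Orb (Fin a ×ₗ Fin b)), HasParity 0 ψ ∧ star ψ ⬝ᵥ ψ = 1 ∧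
      (star ψ ⬝ᵥ (dWaveSourceOpenBoxTT' a b tp U μ h *ᵥ ψ)).re ≤ u * ((a : ℝ) * b) ∧
      nlo * ((a : ℝ) * b) ≤ (star ψ ⬝ᵥ (totalNumber *ᵥ ψ)).re ∧
      (star ψ ⬝ᵥ (totalNumber *ᵥ ψ)).re ≤ nhi * ((a : ℝ) * b) ∧
      e0lo * ((a : ℝ) * b) ≤ (star ψ ⬝ᵥ (dWaveSourceOpenBoxTT' a b tp U μ 0 *ᵥ ψ)).re ∧
      (star ψ ⬝ᵥ (dWaveSourceOpenBoxTT' a b tp U μ 0 *ᵥ ψ)).re ≤ e0hi * ((a : ℝ) * b) ∧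
      dlo * ((a : ℝ) * b) ≤ (star ψ ⬝ᵥ ((∑ x : Fin a ×ₗ Fin b, numberOp x 0 * numberOp x 1) *ᵥ ψ)).re ∧
      (star ψ ⬝ᵥ ((∑ x : Fin a ×ₗ Fin b, numberOp x 0 * numberOp x 1) *ᵥ ψ)).re ≤ dhi * ((a : ℝ) * b)) :
    ∃ ψ : Fock (Orb (Fin a ×ₗ Fin b)), HasParity 0 ψ ∧ star ψ ⬝ᵥ ψ = 1 ∧
      (star ψ ⬝ᵥ (dWaveSourceOpenBoxTT' a b tp U' μ h *ᵥ ψ)).re ≤ (u + (U' - U) * dlo) * ((a : ℝ) * b) ∧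
      nlo * ((a : ℝ) * b) ≤ (star ψ ⬝ᵥ (totalNumber *ᵥ ψ)).re ∧
      (star ψ ⬝ᵥ (totalNumber *ᵥ ψ)).re ≤ nhi * ((a : ℝ) * b) ∧
      (e0lo + (U' - U) * dhi) * ((a : ℝ) * b) ≤ (star ψ ⬝ᵥ (dWaveSourceOpenBoxTT' a b tp U' μ 0 *ᵥ ψ)).re ∧
      (star ψ ⬝ᵥ (dWaveSourceOpenBoxTT' a b tp U' μ 0 *ᵥ ψ)).re ≤ (e0hi + (U' - U) * dlo) * ((a : ℝ) * b) := by
  obtain ⟨ψ, hp, h1, hE, hNlo, hNhi, hE0lo, hE0hi, hDlo, hDhi⟩ := hC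
  exact ⟨ψ, hp, h1, clusterCapTT'_coupling_down hU hE hDlo, hNlo, hNhi, clusterFloorTT'_coupling_down hU hE0lo hDhi,
    clusterCapTT'_coupling_down hU hE0hi hDlo⟩

/-- **Two-field docc node ⇒ two-field node at a LARGER `U`, `t–t′` box** (`U ≤ U′`). [cite: Ruelle1969, §3.3] -/
theorem twoFieldNodeTT'_at_coupling_up_of_twoFieldDoccNodeTT' (hU : U ≤ U')
    (hC : ∃ ψ : Fock (Orb (Fin a ×ₗ Fin b)), HasParity 0 ψ ∧ star ψ ⬝ᵥ ψ = 1 ∧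
      (star ψ ⬝ᵥ (dWaveSourceOpenBoxTT' a b tp U μ h *ᵥ ψ)).re ≤ u * ((a : ℝ) * b) ∧
      nlo * ((a : ℝ) * b) ≤ (star ψ ⬝ᵥ (totalNumber *ᵥ ψ)).re ∧
      (star ψ ⬝ᵥ (totalNumber *ᵥ ψ)).re ≤ nhi * ((a : ℝ) * b) ∧
      e0lo * ((a : ℝ) * b) ≤ (star ψ ⬝ᵥ (dWaveSourceOpenBoxTT' a b tp U μ 0 *ᵥ ψ)).re ∧
      (star ψ ⬝ᵥ (dWaveSourceOpenBoxTT' a b tp U μ 0 *ᵥ ψ)).re ≤ e0hi * ((a : ℝ) * b) ∧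
      dlo * ((a : ℝ) * b) ≤ (star ψ ⬝ᵥ ((∑ x : Fin a ×ₗ Fin b, numberOp x 0 * numberOp x 1) *ᵥ ψ)).re ∧
      (star ψ ⬝ᵥ ((∑ x : Fin a ×ₗ Fin b, numberOp x 0 * numberOp x 1) *ᵥ ψ)).re ≤ dhi * ((a : ℝ) * b)) :
    ∃ ψ : Fock (Orb (Fin a ×ₗ Fin b)), HasParity 0 ψ ∧ star ψ ⬝ᵥ ψ = 1 ∧
      (star ψ ⬝ᵥ (dWaveSourceOpenBoxTT' a b tp U' μ h *ᵥ ψ)).re ≤ (u + (U' - U) * dhi) * ((a : ℝ) * b) ∧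
      nlo * ((a : ℝ) * b) ≤ (star ψ ⬝ᵥ (totalNumber *ᵥ ψ)).re ∧
      (star ψ ⬝ᵥ (totalNumber *ᵥ ψ)).re ≤ nhi * ((a : ℝ) * b) ∧
      (e0lo + (U' - U) * dlo) * ((a : ℝ) * b) ≤ (star ψ ⬝ᵥ (dWaveSourceOpenBoxTT' a b tp U' μ 0 *ᵥ ψ)).re ∧
      (star ψ ⬝ᵥ (dWaveSourceOpenBoxTT' a b tp U' μ 0 *ᵥ ψ)).re ≤ (e0hi + (U' - U) * dhi) * ((a : ℝ) * b) := by
  obtain ⟨ψ, hp, h1, hE, hNlo, hNhi, hE0lo, hE0hi, hDlo, hDhi⟩ := hC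
  exact ⟨ψ, hp, h1, clusterCapTT'_coupling_up hU hE hDhi, hNlo, hNhi, clusterFloorTT'_coupling_up hU hE0lo hDlo,
    clusterCapTT'_coupling_up hU hE0hi hDhi⟩

end Nodes

/-! ### §4 The torus cap row at the new `U` in one statement -/

section TorusRows

variable {a b q L₀ : ℕ} (μ : ℝ) {U U' h u nlo nhi dlo dhi : ℝ}

/-- **Docc node at `U` ⇒ uniform sourced energy CEILING row at a SMALLER `U′`** (`a ∣ q`, `b ∣ q`, `a, b < L₀`; any rational
`e ≥ u + (U′ − U)·dlo`): `SourcedEnergyUpperRow 0 U′ μ h q L₀ e`, by `clusterNode_at_coupling_down_of_doccNode` and pin-1's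
`sourcedEnergyUpperRow_of_exists_clusterState`. [cite: Ruelle1969, §3.3] -/
theorem sourcedEnergyUpperRow_at_coupling_down_of_doccNode (hqa : a ∣ q) (hqb : b ∣ q) (hLa0 : a < L₀) (hLb0 : b < L₀)
    (hU : U' ≤ U) {e : ℚ} (he : u + (U' - U) * dlo ≤ ((e : ℚ) : ℝ))
    (hC : ∃ ψ : Fock (Orb (Fin a ×ₗ Fin b)), HasParity 0 ψ ∧ star ψ ⬝ᵥ ψ = 1 ∧
      (star ψ ⬝ᵥ (dWaveSourceOpenBox a b U μ h *ᵥ ψ)).re ≤ u * ((a : ℝ) * b) ∧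
      nlo * ((a : ℝ) * b) ≤ (star ψ ⬝ᵥ (totalNumber *ᵥ ψ)).re ∧
      (star ψ ⬝ᵥ (totalNumber *ᵥ ψ)).re ≤ nhi * ((a : ℝ) * b) ∧
      dlo * ((a : ℝ) * b) ≤ (star ψ ⬝ᵥ ((∑ x : Fin a ×ₗ Fin b, numberOp x 0 * numberOp x 1) *ᵥ ψ)).re ∧
      (star ψ ⬝ᵥ ((∑ x : Fin a ×ₗ Fin b, numberOp x 0 * numberOp x 1) *ᵥ ψ)).re ≤ dhi * ((a : ℝ) * b)) :
    SourcedEnergyUpperRow 0 U' μ h q L₀ e := by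
  obtain ⟨ψ, hp, h1, hE, -, -⟩ := clusterNode_at_coupling_down_of_doccNode μ hU hC
  have hab : (0 : ℝ) ≤ (a : ℝ) * b := by positivity
  exact sourcedEnergyUpperRow_of_exists_clusterState hqa hqb hLa0 hLb0 U' μ h
    ⟨ψ, hp, h1, hE.trans (mul_le_mul_of_nonneg_right he hab)⟩

/-- **Docc node at `U` ⇒ uniform sourced energy CEILING row at a LARGER `U′`** (any rational `e ≥ u + (U′ − U)·dhi`).
[cite: Ruelle1969, §3.3] -/
theorem sourcedEnergyUpperRow_at_coupling_up_of_doccNode (hqa : a ∣ q) (hqb : b ∣ q) (hLa0 : a < L₀) (hLb0 : b < L₀)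
    (hU : U ≤ U') {e : ℚ} (he : u + (U' - U) * dhi ≤ ((e : ℚ) : ℝ))
    (hC : ∃ ψ : Fock (Orb (Fin a ×ₗ Fin b)), HasParity 0 ψ ∧ star ψ ⬝ᵥ ψ = 1 ∧
      (star ψ ⬝ᵥ (dWaveSourceOpenBox a b U μ h *ᵥ ψ)).re ≤ u * ((a : ℝ) * b) ∧
      nlo * ((a : ℝ) * b) ≤ (star ψ ⬝ᵥ (totalNumber *ᵥ ψ)).re ∧
      (star ψ ⬝ᵥ (totalNumber *ᵥ ψ)).re ≤ nhi * ((a : ℝ) * b) ∧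
      dlo * ((a : ℝ) * b) ≤ (star ψ ⬝ᵥ ((∑ x : Fin a ×ₗ Fin b, numberOp x 0 * numberOp x 1) *ᵥ ψ)).re ∧
      (star ψ ⬝ᵥ ((∑ x : Fin a ×ₗ Fin b, numberOp x 0 * numberOp x 1) *ᵥ ψ)).re ≤ dhi * ((a : ℝ) * b)) :
    SourcedEnergyUpperRow 0 U' μ h q L₀ e := by
  obtain ⟨ψ, hp, h1, hE, -, -⟩ := clusterNode_at_coupling_up_of_doccNode μ hU hC
  have hab : (0 : ℝ) ≤ (a : ℝ) * b := by positivity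
  exact sourcedEnergyUpperRow_of_exists_clusterState hqa hqb hLa0 hLb0 U' μ h
    ⟨ψ, hp, h1, hE.trans (mul_le_mul_of_nonneg_right he hab)⟩

end TorusRows

end Summit.Ventures.CertifiedManyBodySolver.Observables

end
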